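import Literature.NumberTheory.Transcendental.CuspValueAlgebraic
import Mathlib.FieldTheory.AlgebraicClosure
import Mathlib.Algebra.Polynomial.Lifts
import HarnessLib

/-!
# Limit values on relations with ALGEBRAIC coefficients are algebraic

`CuspValueAlgebraic.lean` for bivariate polynomials with algebraic (rather than rational)
coefficients: if `P ∈ ℂ[Y][X]` is nonzero with all coefficients algebraic over `ℚ`, and
`P(u_n, v_n) = 0` with `|u_n| → ∞`, `v_n → b`, then `b` is algebraic over `ℚ`
(`isAlgebraic_of_tendsto_of_eval₂_eq_zero_of_coeff`). The top `X`-coefficient `c_K ∈ ℂ[Y]`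
vanishes at `b` by the domination lemma `sum_range_succ_mul_pow_ne_zero`; it lifts to a nonzero
polynomial over the algebraic closure `L` of `ℚ` in `ℂ`, so `b` is algebraic over `L`, hence over
`ℚ` (`isIntegral_trans`). This is the form needed for the SECOND arithmetic datum of a linear cusp
of a ℚ-curve: after the slope `β ∈ ℚ̄` is known, the constant `γ₀ = lim (x₂ − βx₁)` solves the
relation `P(x₁, βx₁ + w) = 0`, whose coefficients lie in `ℚ(β) ⊆ ℚ̄` (crux `RigidCore.SparsityTwo`,
line cusp-germ-schneider-sparsity, stub (★)). [folklore]
-/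

noncomputable section

open Filter Polynomial
open _root_.Topology

namespace Literature.NumberTheory.Transcendental

/-- A complex root of a nonzero polynomial with algebraic coefficients is algebraic. [folklore] -/
theorem isAlgebraic_of_eval_eq_zero_of_coeff_isAlgebraic {c : Polynomial ℂ} (hc : c ≠ 0)
    (halg : ∀ j, IsAlgebraic ℚ (c.coeff j)) {b : ℂ} (hb : c.eval b = 0) : IsAlgebraic ℚ b := by
  set L := algebraicClosure ℚ ℂ with hL
  -- lift `c` to `L[Y]`
  have hlift : c ∈ Polynomial.lifts (algebraMap L ℂ) := by
    rw [Polynomial.lifts_iff_coeff_lifts]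
    intro j
    exact ⟨⟨c.coeff j, (mem_algebraicClosure_iff).mpr (halg j)⟩, rfl⟩
  obtain ⟨q, hq⟩ := (Polynomial.mem_lifts c).mp hlift
  have hq0 : q ≠ 0 := by
    rintro rfl
    rw [Polynomial.map_zero] at hq
    exact hc hq.symm
  have hroot : aeval b q = 0 := by
    rw [aeval_def, ← eval_map, hq, hb]
  have hbLalg : IsAlgebraic L b := ⟨q, hq0, hroot⟩
  have hbL : IsIntegral L b := hbLalg.isIntegral
  haveI : Algebra.IsAlgebraic ℚ L := algebraicClosure.isAlgebraic ℚ ℂ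
  haveI : Algebra.IsIntegral ℚ L := Algebra.IsAlgebraic.isIntegral
  exact (isIntegral_trans (R := ℚ) b hbL).isAlgebraic

/-- **The limit of the bounded coordinate is algebraic (algebraic coefficients).** Let
`P ∈ ℂ[Y][X]` be nonzero with all coefficients algebraic over `ℚ`, and let `u v : ℕ → ℂ` with
`‖u n‖ → ∞`, `v n → b` and `P(X = u n, Y = v n) = 0` for all `n`. Then `b` is algebraic over `ℚ`.
[folklore] -/
theorem isAlgebraic_of_tendsto_of_eval₂_eq_zero_of_coeff (P : Polynomial (Polynomial ℂ))
    (hP : P ≠ 0) (halg : ∀ i j, IsAlgebraic ℚ ((P.coeff i).coeff j))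
    {u v : ℕ → ℂ} {b : ℂ} (hu : Tendsto (fun n => ‖u n‖) atTop atTop)
    (hv : Tendsto v atTop (𝓝 b)) (h : ∀ n, P.eval₂ (evalRingHom (v n)) (u n) = 0) :
    IsAlgebraic ℚ b := by
  classical
  set K := P.natDegree with hK
  set c : ℕ → ℂ → ℂ := fun k y => (P.coeff k).eval y with hc
  have heval : ∀ n, ∑ k ∈ Finset.range (K + 1), c k (v n) * (u n) ^ k = 0 := by
    intro n
    have := h n
    rw [Polynomial.eval₂_eq_sum_range] at this
    simpa [hc, hK, coe_evalRingHom] using this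
  have hlead : P.coeff K ≠ 0 := by
    rw [hK]; exact Polynomial.leadingCoeff_ne_zero.mpr hP
  -- claim: `c K b = 0`, then conclude with the algebraic-coefficient root lemma
  suffices hroot : c K b = 0 from
    isAlgebraic_of_eval_eq_zero_of_coeff_isAlgebraic hlead (halg K) hroot
  by_contra hne
  have hcont : ∀ k, Tendsto (fun n => c k (v n)) atTop (𝓝 (c k b)) := fun k =>
    ((P.coeff k).continuous.tendsto b).comp hv
  set δ : ℝ := ‖c K b‖ / 2 with hδ
  have hδpos : 0 < δ := by
    have : 0 < ‖c K b‖ := norm_pos_iff.mpr hne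
    rw [hδ]; linarith
  have hbig : ∀ᶠ n in atTop, δ ≤ ‖c K (v n)‖ := by
    have h1 : Tendsto (fun n => ‖c K (v n)‖) atTop (𝓝 ‖c K b‖) := (hcont K).norm
    have h2 : δ < ‖c K b‖ := by rw [hδ]; linarith [norm_pos_iff.mpr hne]
    exact (h1.eventually (lt_mem_nhds h2)).mono fun n hn => hn.le
  set S : ℝ := ∑ k ∈ Finset.range K, (‖c k b‖ + 1) with hS
  have hsmall : ∀ᶠ n in atTop, ∑ k ∈ Finset.range K, ‖c k (v n)‖ ≤ S := by
    have hk : ∀ k, ∀ᶠ n in atTop, ‖c k (v n)‖ ≤ ‖c k b‖ + 1 := by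
      intro k
      have h1 : Tendsto (fun n => ‖c k (v n)‖) atTop (𝓝 ‖c k b‖) := (hcont k).norm
      exact (h1.eventually (gt_mem_nhds (lt_add_one _))).mono fun n hn => hn.le
    have hall : ∀ᶠ n in atTop, ∀ k ∈ Finset.range K, ‖c k (v n)‖ ≤ ‖c k b‖ + 1 :=
      (Finset.eventually_all (Finset.range K)).mpr fun k _ => hk k
    filter_upwards [hall] with n hn
    exact Finset.sum_le_sum hn
  have hx1 : ∀ᶠ n in atTop, 1 ≤ ‖u n‖ := hu.eventually (eventually_ge_atTop 1)
  have hx : ∀ᶠ n in atTop, S < δ * ‖u n‖ := by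
    have : Tendsto (fun n => δ * ‖u n‖) atTop atTop := hu.const_mul_atTop hδpos
    exact this.eventually (eventually_gt_atTop S)
  obtain ⟨n, hn⟩ := (((hbig.and hsmall).and hx1).and hx).exists
  exact sum_range_succ_mul_pow_ne_zero (fun k => c k (v n)) hn.1.1.1 hn.1.1.2 hn.1.2 hn.2 (heval n)

end Literature.NumberTheory.Transcendental

end
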